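import Mathlib.Analysis.InnerProductSpace.Projection.Basic

/-!
# T⁴ programme, spine node NE2 (U1a), lane P2 — toward (GF3) WITH BACKGROUND, file 1: TWO ORTHOGONAL PROJECTIONS WHOSE RANGES APPROXIMATE EACH OTHER —
# `(1 − ε)·‖P v‖ ≤ ‖P′ v‖ + ε′·‖v‖` from the one-sided closeness data `∀ y ∈ S, ‖y − P′y‖ ≤ ε‖y‖`, `∀ y′ ∈ S′, ‖y′ − P y′‖ ≤ ε′‖y′‖`, and the closeness data
# themselves from a RELATIVE BOUND `‖T k − T′ k‖ ≤ ε‖T k‖` on `K` when `S = T(K)`, `S′ = T′(K)` (abstract inner-product-space lemmas, [folklore])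

NE2 formalisation swarm `b2b-balaban-t4-ne2-formalise-*`, leaf prover 03 GEN 6 (`prover-b2b-balaban-t4-ne2-formalise-leaf-03-g6-0`); journal INTENT
CLAIMS.log 2026-08-20 «(GF3) WITH BACKGROUND IN THE REGULAR GAUGE».  PURPOSE.  The coercivity binder (GF3) of the vector END for Bałaban's projected gauge
functional `projG R K = ‖Π_{S_R(K)} div_R W‖²` (leaf-09-g7 p221888) is a kernel fact at `U = 1` (`VariationalVectorGaugeSliceB5.garding_flat`, from pv15's
(1.90)) and numerically n-uniform with background (memo `t4/T4-EST-NE2-P2-REG.md` §3, kit j101794).  In a REGULAR small gauge the slice subspace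
`S_R(K) = div_R D_R(K)` is `O(α)`-close to the flat `Δ(K)` because `div_R D_R − Δ` is RELATIVELY `Δ`-bounded on `K` (file 2); this file is the abstract
Hilbert-space step turning such a relative bound into two-sided comparison of the projected norms — the only place where the two projections meet.

CONTENTS ([folklore]; any `RCLike 𝕜`, any inner product space; subspaces with orthogonal projections).
 * §1 `norm_sub_starProjection_le_of_mem` (`‖y − P′y‖ ≤ ‖y − w‖` for `w ∈ S′`, Pythagoras), **`oneSided_of_relBound`**: if `‖T k − T′ k‖ ≤ ε·‖T k‖` on `K` then
   every `y ∈ T(K)` has `‖y − Π_{T′(K)} y‖ ≤ ε·‖y‖`; `relBound_symm` (`ε < 1` ⟹ the reverse relative bound with `ε/(1−ε)`).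
 * §2 `norm_starProjection_of_mem_orthogonal_le` (`z ⊥ S`, `S′` ε′-close to `S` ⟹ `‖P′z‖ ≤ ε′‖z‖`), **`norm_starProjection_le_of_oneSided`**:
   `(1 − ε)·‖P v‖ ≤ ‖P′ v‖ + ε′·‖v‖`, and the complementary form **`norm_sub_starProjection_le_of_oneSided`**: `‖v − P′v‖ ≤ ‖v − Pv‖ + ε·‖Pv‖`.

HONEST FRAMING (T4-DAG p. 1).  Pure linear algebra, no lattice objects; [folklore]; no `def`, no `sorry`; axioms standard.  Nothing about NE2 is proved here;
spine PROVED 0∕9; NOT infinite volume ∕ mass gap ∕ Clay.  HONEST DEPENDENCY (cell, verbatim): continuum YM on T⁴ ⇐ BetaPertH ∧ nine spine estimates (0/9 proved);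
BetaPertH ⇐ (D1) ∧ (D4) ∧ CAP+tail; G-an2-4 gates asym, D1 and NE2/3/4.
-/

noncomputable section

namespace Summit.QuantumFields.BalabanUV.T4Continuum.SubspacePairPerturbation

open scoped InnerProductSpace

variable {𝕜 : Type*} [RCLike 𝕜] {H : Type*} [NormedAddCommGroup H] [InnerProductSpace 𝕜 H]

/-! ## §1 One-sided closeness of `T′(K)` to `T(K)` from a relative bound -/

/-- the orthogonal projection is the nearest point: `‖y − P′y‖ ≤ ‖y − w‖` for every `w ∈ S′`. [folklore] -/
theorem norm_sub_starProjection_le_of_mem (S' : Submodule 𝕜 H) [S'.HasOrthogonalProjection] (y : H) {w : H} (hw : w ∈ S') :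
    ‖y - S'.starProjection y‖ ≤ ‖y - w‖ := by
  have hmem : S'.starProjection y - w ∈ S' := S'.sub_mem (S'.starProjection_apply_mem y) hw
  have horth : ⟪y - S'.starProjection y, S'.starProjection y - w⟫_𝕜 = 0 := S'.starProjection_inner_eq_zero y _ hmem
  have hpy := norm_add_sq_eq_norm_sq_add_norm_sq_of_inner_eq_zero _ _ horth
  rw [sub_add_sub_cancel] at hpy
  nlinarith [norm_nonneg (y - w), norm_nonneg (y - S'.starProjection y), norm_nonneg (S'.starProjection y - w)]

/-- **ONE-SIDED CLOSENESS FROM A RELATIVE BOUND**: if `‖T k − T′ k‖ ≤ ε·‖T k‖` for all `k ∈ K` then every `y ∈ T(K)` satisfies `‖y − Π_{T′(K)} y‖ ≤ ε·‖y‖`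
(no injectivity of `T` needed: any preimage of `y` in `K` will do). [folklore] -/
theorem oneSided_of_relBound {V : Type*} [AddCommGroup V] [Module 𝕜 V] (T T' : V →ₗ[𝕜] H) (K : Submodule 𝕜 V) [(K.map T').HasOrthogonalProjection]
    {ε : ℝ} (h : ∀ k ∈ K, ‖T k - T' k‖ ≤ ε * ‖T k‖) : ∀ y ∈ K.map T, ‖y - (K.map T').starProjection y‖ ≤ ε * ‖y‖ := by
  intro y hy
  obtain ⟨k, hk, rfl⟩ := Submodule.mem_map.mp hy
  exact (norm_sub_starProjection_le_of_mem (K.map T') (T k) (Submodule.mem_map_of_mem hk)).trans (h k hk)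

omit [InnerProductSpace 𝕜 H] in
/-- the relative bound is symmetric up to `ε ↦ ε/(1 − ε)`: `‖T k − T′ k‖ ≤ ε‖T k‖`, `0 ≤ ε < 1` ⟹ `‖T′ k − T k‖ ≤ (ε/(1−ε))·‖T′ k‖`. [folklore] -/
theorem relBound_symm {V : Type*} (T T' : V → H) {ε : ℝ} (hε0 : 0 ≤ ε) (hε : ε < 1) {k : V} (h : ‖T k - T' k‖ ≤ ε * ‖T k‖) :
    ‖T' k - T k‖ ≤ ε / (1 - ε) * ‖T' k‖ := by
  have h1 : ‖T k‖ ≤ ‖T' k‖ + ‖T k - T' k‖ := by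
    calc ‖T k‖ = ‖(T k - T' k) + T' k‖ := by rw [sub_add_cancel]
      _ ≤ ‖T k - T' k‖ + ‖T' k‖ := norm_add_le _ _
      _ = _ := add_comm _ _
  have h2 : (1 - ε) * ‖T k‖ ≤ ‖T' k‖ := by nlinarith [h, h1, norm_nonneg (T k)]
  rw [norm_sub_rev, div_mul_eq_mul_div, le_div_iff₀ (by linarith)]
  calc ‖T k - T' k‖ * (1 - ε) ≤ ε * ‖T k‖ * (1 - ε) := mul_le_mul_of_nonneg_right h (by linarith)
    _ = ε * ((1 - ε) * ‖T k‖) := by ring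
    _ ≤ ε * ‖T' k‖ := mul_le_mul_of_nonneg_left h2 hε0

/-! ## §2 Two orthogonal projections with mutually close ranges -/

/-- if `S′` is `ε′`-close to `S` (`‖y′ − P y′‖ ≤ ε′‖y′‖` on `S′`, `0 ≤ ε′`) then `P′` is small on `Sᗮ`: `‖P′ z‖ ≤ ε′·‖z‖` for `z ⊥ S`. [folklore] -/
theorem norm_starProjection_of_mem_orthogonal_le (S S' : Submodule 𝕜 H) [S.HasOrthogonalProjection] [S'.HasOrthogonalProjection] {ε' : ℝ} (hε' : 0 ≤ ε')
    (h' : ∀ y' ∈ S', ‖y' - S.starProjection y'‖ ≤ ε' * ‖y'‖) {z : H} (hz : z ∈ Sᗮ) : ‖S'.starProjection z‖ ≤ ε' * ‖z‖ := by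
  set q := S'.starProjection z with hq
  -- `‖q‖² = re⟪q, z⟫ = re⟪q − P q, z⟫ ≤ ‖q − Pq‖‖z‖ ≤ ε′‖q‖‖z‖`
  have h1 : ‖q‖ ^ 2 = RCLike.re ⟪q, z⟫_𝕜 := by
    rw [hq, Submodule.re_inner_starProjection_eq_normSq, Submodule.starProjection_apply, Submodule.coe_norm]
  have h2 : ⟪S.starProjection q, z⟫_𝕜 = 0 := by
    rw [Submodule.inner_starProjection_left_eq_right, (Submodule.starProjection_apply_eq_zero_iff S).mpr hz, inner_zero_right]
  have h3 : RCLike.re ⟪q, z⟫_𝕜 = RCLike.re ⟪q - S.starProjection q, z⟫_𝕜 := by rw [inner_sub_left, h2, sub_zero]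
  have h4 : RCLike.re ⟪q - S.starProjection q, z⟫_𝕜 ≤ ‖q - S.starProjection q‖ * ‖z‖ := (RCLike.re_le_norm _).trans (norm_inner_le_norm _ _)
  have h5 : ‖q - S.starProjection q‖ ≤ ε' * ‖q‖ := h' q (S'.starProjection_apply_mem z)
  have h6 : ‖q‖ * ‖q‖ ≤ (ε' * ‖z‖) * ‖q‖ := by
    rw [← sq, h1, h3]; exact h4.trans (by nlinarith [mul_le_mul_of_nonneg_right h5 (norm_nonneg z)])
  rcases (norm_nonneg q).eq_or_lt with hq0 | hqpos
  · rw [← hq0]; positivity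
  · exact le_of_mul_le_mul_right h6 hqpos

/-- the complementary projection is a contraction: `‖v − P v‖ ≤ ‖v‖`. [folklore] -/
theorem norm_sub_starProjection_le (S : Submodule 𝕜 H) [S.HasOrthogonalProjection] (v : H) : ‖v - S.starProjection v‖ ≤ ‖v‖ := by
  simpa using norm_sub_starProjection_le_of_mem S v S.zero_mem

/-- **TWO PROJECTIONS WITH MUTUALLY CLOSE RANGES**: if every `y ∈ S` has `‖y − P′y‖ ≤ ε‖y‖` and every `y′ ∈ S′` has `‖y′ − Py′‖ ≤ ε′‖y′‖` (`0 ≤ ε′`), then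
for every `v`: `(1 − ε)·‖P v‖ ≤ ‖P′ v‖ + ε′·‖v‖`. [folklore] -/
theorem norm_starProjection_le_of_oneSided (S S' : Submodule 𝕜 H) [S.HasOrthogonalProjection] [S'.HasOrthogonalProjection] {ε ε' : ℝ} (hε' : 0 ≤ ε')
    (h : ∀ y ∈ S, ‖y - S'.starProjection y‖ ≤ ε * ‖y‖) (h' : ∀ y' ∈ S', ‖y' - S.starProjection y'‖ ≤ ε' * ‖y'‖) (v : H) :
    (1 - ε) * ‖S.starProjection v‖ ≤ ‖S'.starProjection v‖ + ε' * ‖v‖ := by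
  set p := S.starProjection v with hp
  -- `‖p‖ ≤ ‖P′p‖ + ‖p − P′p‖ ≤ ‖P′p‖ + ε‖p‖`
  have h1 : ‖p‖ ≤ ‖S'.starProjection p‖ + ε * ‖p‖ := by
    calc ‖p‖ = ‖S'.starProjection p + (p - S'.starProjection p)‖ := by rw [add_sub_cancel]
      _ ≤ ‖S'.starProjection p‖ + ‖p - S'.starProjection p‖ := norm_add_le _ _
      _ ≤ _ := add_le_add le_rfl (h p (S.starProjection_apply_mem v))
  -- `P′p = P′v − P′(v − p)`, `v − p ∈ Sᗮ` so `‖P′(v − p)‖ ≤ ε′‖v − p‖ ≤ ε′‖v‖`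
  have hz : v - p ∈ Sᗮ := S.sub_starProjection_mem_orthogonal v
  have h2 : ‖S'.starProjection (v - p)‖ ≤ ε' * ‖v‖ :=
    (norm_starProjection_of_mem_orthogonal_le S S' hε' h' hz).trans (mul_le_mul_of_nonneg_left (norm_sub_starProjection_le S v) hε')
  have h3 : ‖S'.starProjection p‖ ≤ ‖S'.starProjection v‖ + ε' * ‖v‖ := by
    have e : S'.starProjection p = S'.starProjection v - S'.starProjection (v - p) := by rw [map_sub, sub_sub_cancel]
    rw [e]
    exact (norm_sub_le _ _).trans (add_le_add le_rfl h2)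
  nlinarith [h1, h3]

/-- **THE COMPLEMENTARY FORM**: if every `y ∈ S` has `‖y − P′y‖ ≤ ε‖y‖` then `‖v − P′v‖ ≤ ‖v − Pv‖ + ε·‖Pv‖` for every `v`. [folklore] -/
theorem norm_sub_starProjection_le_of_oneSided (S S' : Submodule 𝕜 H) [S.HasOrthogonalProjection] [S'.HasOrthogonalProjection] {ε : ℝ}
    (h : ∀ y ∈ S, ‖y - S'.starProjection y‖ ≤ ε * ‖y‖) (v : H) :
    ‖v - S'.starProjection v‖ ≤ ‖v - S.starProjection v‖ + ε * ‖S.starProjection v‖ := by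
  set p := S.starProjection v with hp
  -- `P′(P′p) ∈ S′`, nearest point: `‖v − P′v‖ ≤ ‖v − P′p‖ ≤ ‖v − p‖ + ‖p − P′p‖`
  calc ‖v - S'.starProjection v‖ ≤ ‖v - S'.starProjection p‖ := norm_sub_starProjection_le_of_mem S' v (S'.starProjection_apply_mem p)
    _ = ‖(v - p) + (p - S'.starProjection p)‖ := by rw [sub_add_sub_cancel]
    _ ≤ ‖v - p‖ + ‖p - S'.starProjection p‖ := norm_add_le _ _
    _ ≤ _ := add_le_add le_rfl (h p (S.starProjection_apply_mem v))

end Summit.QuantumFields.BalabanUV.T4Continuum.SubspacePairPerturbation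

end
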